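import Summits.AtomisticToContinuum.Crystallization.Theses.ThreeConeCertificate
import Summits.AtomisticToContinuum.Crystallization.Theorems.ThreeConeCertificateDefs
import Summits.AtomisticToContinuum.Crystallization.Theorems.ThreeConeCertificateOnePercentCertificatePeriodicReduction
import Summits.AtomisticToContinuum.Crystallization.Theorems.OnePercentCertificate.Negative.StubLocal
import Summits.AtomisticToContinuum.Crystallization.Theorems.ThreeConeCertificateOnePercentCertificateBookingSum

/-!
# `OnePercentCertificate` (stmt-AtomisticToContinuum-11958) — line `SketchIdeator5`: windowed bookings at the
periodic level give the crux

Supports file of the line `SketchIdeator5` (lead a2).  Lagarias's local-density theorem in energy form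
(`FiveRingBooking.stub_bookingSum`, landed) is applied to ONE PERIOD of a periodic configuration: if the sites of
the motif carry booked energy `A` (total `#motif · e_V(P)`), content `B` (total `≤ #motif`), an antisymmetric
flow `φ` and column-stochastic window weights `M` whose windowed corrected stars are all `≥ 0`, then
`−κ ≤ e_V(P)` (`periodicBound_of_windowedBooking`, any potential `V`, any `κ ≥ 0`).  Hence a certified windowed
booking of `gS` at `κ = cS` on every periodic configuration gives `OnePercentCertificate` through the tree
reduction `OnePercentPeriodic.onePercentCertificate_of_periodicLocalConstant` (p115021 ∘ p112372):
`onePercentCertificate_of_windowedBookings` (registered sub-goal of the line; its hypothesis is the line's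
open stub `stub_certifiedWindowedBooking` verbatim).  All `[folklore]`.
-/

noncomputable section

open scoped BigOperators
open Literature.MathematicalPhysics.StatisticalMechanics
open Summit.AtomisticToContinuum.Crystallization.Theorems
open Summit.AtomisticToContinuum.Crystallization.Theorems.ThreeConeSplit

namespace Summit.AtomisticToContinuum.Crystallization.Theorems.FiveRingBooking

/-- **Windowed booking of one period ⇒ energy bound.** For a periodic configuration `P`, a potential `V`
and `κ ≥ 0`: booking data on the motif — `A` with `∑ A = #motif · e_V(P)`, `B` with `∑ B ≤ #motif`, an
antisymmetric flow `φ`, window weights `M` with unit column sums — whose windowed corrected stars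
`∑_b M a b (A b + κ B b + ∑_c φ b c)` are all `≥ 0` give `−κ ≤ e_V(P)` (`stub_bookingSum` with
`E = #motif · e_V(P)`, `n = #motif`, then division by `#motif > 0`). [folklore] -/
theorem periodicBound_of_windowedBooking (V : ℝ → ℝ) {κ : ℝ} (hκ : 0 ≤ κ) (P : PeriodicConfiguration 3)
    (h : ∃ (A B : ↥P.motif → ℝ) (φ M : ↥P.motif → ↥P.motif → ℝ),
        (∀ a b, φ a b = -φ b a) ∧ ∑ a, A a = (P.motif.card : ℝ) * P.energyPerParticle V ∧
        ∑ a, B a ≤ (P.motif.card : ℝ) ∧ (∀ a b, 0 ≤ M a b) ∧ (∀ b, ∑ a, M a b = 1) ∧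
        ∀ a, 0 ≤ ∑ b, M a b * (A b + κ * B b + ∑ c, φ b c)) :
    -κ ≤ P.energyPerParticle V := by
  obtain ⟨A, B, φ, M, hφ, hA, hB, hM, hM1, hpos⟩ := h
  have key := stub_bookingSum ((P.motif.card : ℝ) * P.energyPerParticle V) κ (P.motif.card : ℝ)
    A B φ M hκ hφ hA hB hM hM1 hpos
  have hcard : (0 : ℝ) < (P.motif.card : ℝ) := by
    exact_mod_cast Finset.card_pos.mpr P.motif_nonempty
  by_contra hlt
  push Not at hlt
  have : (P.motif.card : ℝ) * P.energyPerParticle V < (P.motif.card : ℝ) * (-κ) :=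
    mul_lt_mul_of_pos_left hlt hcard
  linarith

/-- `0 ≤ cS` (`cS = 657987/10⁶`). [folklore] -/
theorem cS_nonneg' : 0 ≤ cS := by
  rw [StubLocal.cS_eq]; norm_num

/-- **Registered sub-goal `onePercentCertificate_of_windowedBookings`.** A certified windowed booking of the
finite-range part `gS` at `κ = cS` on EVERY periodic configuration of `ℝ³` (the line's open stub
`stub_certifiedWindowedBooking`, verbatim as hypothesis) gives the crux `OnePercentCertificate` by name: the
periodic local constant `∀ P, −cS ≤ e_gS(P)` from `periodicBound_of_windowedBooking`, then the tree reduction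
`onePercentCertificate_of_periodicLocalConstant` (periodisation, decomposition, slack sign, range, positive type,
value). [folklore] -/
theorem onePercentCertificate_of_windowedBookings : (∀ P : PeriodicConfiguration 3, ∃ (A B : ↥P.motif → ℝ) (φ M : ↥P.motif → ↥P.motif → ℝ), (∀ a b, φ a b = -φ b a) ∧ ∑ a, A a = (P.motif.card : ℝ) * P.energyPerParticle gS ∧ ∑ a, B a ≤ (P.motif.card : ℝ) ∧ (∀ a b, 0 ≤ M a b) ∧ (∀ b, ∑ a, M a b = 1) ∧ ∀ a, 0 ≤ ∑ b, M a b * (A b + cS * B b + ∑ c, φ b c)) → Summit.AtomisticToContinuum.Crystallization.Theses.ThreeConeCertificate.OnePercentCertificate := by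
  intro h
  exact OnePercentPeriodic.onePercentCertificate_of_periodicLocalConstant
    (fun P => periodicBound_of_windowedBooking gS cS_nonneg' P (h P))

end Summit.AtomisticToContinuum.Crystallization.Theorems.FiveRingBooking
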